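import Literature.RingTheory.PBasis.KimuraNiitsuma1980
import HarnessLib

/-!
# Route `RadicialJung`, crux `CleanModels` (stmt-15917): THE GROUND FIELD IS FINITELY GENERATED
# OVER `k^p(A)` — piece (F2) of the T2 `p`-basis discharge

Support file (OURS) for PROGRAMME-clean-dim2 / T2 (`HOME/L/res-L0-w81-pv-2/g5/T2-ARCHITECTURE.md`).

**(F2).** Let `κ` be a field of characteristic `p`, `k' ⊆ κ` a subfield over which `κ` is spanned
by finitely many elements `e_1, …, e_n`, and `A ⊆ k'` such that `k' ⊆ κ^p[A]`
(`κ^p[A] = Subring.closure (range (frobenius κ p) ∪ A)`; this is what a maximal subset of `k'`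
that is `p`-independent in `κ` satisfies). Then there are finitely many `b_1, …, b_m ∈ k'` with
`k' ⊆ k'^p[A, b]` (`exists_finset_subfield_subset_closure`): indeed `κ^p[A]` is contained in the
`k'^p(A)`-span of `e_1^p, …, e_n^p` (a subring), so `k'` is a subspace of a finite-dimensional
`k'^p(A)`-vector space. This replaces Kimura–Niitsuma's count `[K : K^p(A)] = p^r` (Thm. 3.4,
proof) at a CLOSED point, where the residue field is finite over the ground field.

References: T. Kimura, H. Niitsuma, J. Math. Soc. Japan 32 (1980), Thm. 3.4 (proof, p. 370).
[cite: KimuraNiitsuma1980, Thm. 3.4 p. 370]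
-/

noncomputable section

open Literature.RingTheory.PBasis

namespace Summit.ResolutionOfSingularities.ResolutionOfSingularities.Theorems.RadicialJung.CleanModels

universe u

variable {κ : Type u} [Field κ] (p : ℕ) [Fact p.Prime] [CharP κ p]

/-- A subring of `κ` inside a subfield `k'` and containing `k'^p` is closed under inverses:
`z⁻¹ = z^{p-1} · (z⁻¹)^p`. [folklore] -/
theorem inv_mem_subringClosure_of_frobenius_image (k' : Subfield κ) (s : Set κ) (hsk : s ⊆ k')
    (hs : frobenius κ p '' (k' : Set κ) ⊆ s) {z : κ} (hz : z ∈ Subring.closure s) :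
    z⁻¹ ∈ Subring.closure s := by
  have hp : 1 ≤ p := (Fact.out : p.Prime).one_lt.le
  by_cases hz0 : z = 0
  · rw [hz0, inv_zero]; exact Subring.zero_mem _
  have hzk : z ∈ k' := (Subring.closure_le.mpr hsk : Subring.closure s ≤ k'.toSubring) hz
  have h2 : z⁻¹ = z ^ (p - 1) * (z⁻¹) ^ p := by
    obtain ⟨q, hq⟩ : ∃ q, p = q + 1 := ⟨p - 1, (Nat.sub_add_cancel hp).symm⟩
    rw [hq, Nat.add_sub_cancel, pow_succ, ← mul_assoc, ← mul_pow, mul_inv_cancel₀ hz0, one_pow,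
      one_mul]
  rw [h2]
  exact Subring.mul_mem _ (Subring.pow_mem _ hz _)
    (Subring.subset_closure (hs ⟨z⁻¹, k'.inv_mem hzk, frobenius_def _ _⟩))

/-- **(F2)**: if `κ` is finite over the subfield `k'` and `k' ⊆ κ^p[A]` with `A ⊆ k'`, then `k'` is
generated over `k'^p[A]` by finitely many elements, as a ring. [cite: KimuraNiitsuma1980, Thm. 3.4 p. 370] -/
theorem exists_finset_subfield_subset_closure (k' : Subfield κ) {n : ℕ} (e : Fin n → κ)
    (he : ∀ z : κ, ∃ c : Fin n → κ, (∀ i, c i ∈ k') ∧ z = ∑ i, c i * e i)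
    (A : Set κ) (hAk : A ⊆ k')
    (hk' : (k' : Set κ) ⊆ Subring.closure (Set.range (frobenius κ p) ∪ A)) :
    ∃ b : Finset κ, (↑b : Set κ) ⊆ k' ∧
      (k' : Set κ) ⊆ Subring.closure (frobenius κ p '' (k' : Set κ) ∪ A ∪ ↑b) := by
  classical
  -- `L = k'^p(A) ⊆ k'`
  let L : Subfield κ := Subfield.closure (frobenius κ p '' (k' : Set κ) ∪ A)
  have hgen_k : frobenius κ p '' (k' : Set κ) ∪ A ⊆ k' := by
    rintro z (⟨w, hw, rfl⟩ | hz)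
    · exact k'.pow_mem hw _
    · exact hAk hz
  have hLk : L ≤ k' := Subfield.closure_le.mpr hgen_k
  -- `V` = the `L`-span of the `e_i^p`
  let V : Submodule L κ := Submodule.span L (Set.range fun i => e i ^ p)
  have hfrobV : ∀ z : κ, z ^ p ∈ V := by
    intro z
    obtain ⟨c, hc, rfl⟩ := he z
    rw [← frobenius_def, map_sum]
    refine Submodule.sum_mem _ fun i _ => ?_
    rw [map_mul, frobenius_def, frobenius_def]
    have hci : c i ^ p ∈ L := Subfield.subset_closure (Or.inl ⟨c i, hc i, frobenius_def _ _⟩)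
    have : c i ^ p * e i ^ p = (⟨c i ^ p, hci⟩ : L) • e i ^ p := by rw [Algebra.smul_def]; rfl
    rw [this]
    exact Submodule.smul_mem _ _ (Submodule.subset_span ⟨i, rfl⟩)
  have hVmul_pow : ∀ v ∈ V, ∀ z : κ, v * z ^ p ∈ V := by
    intro v hv z
    refine Submodule.span_induction (p := fun v _ => v * z ^ p ∈ V) ?_ ?_ ?_ ?_ hv
    · rintro _ ⟨i, rfl⟩
      rw [← mul_pow]; exact hfrobV _
    · rw [zero_mul]; exact Submodule.zero_mem _
    · intro v w _ _ hv hw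
      rw [add_mul]; exact Submodule.add_mem _ hv hw
    · intro l v _ hv
      rw [smul_mul_assoc]; exact Submodule.smul_mem _ _ hv
  have hVmul : ∀ v ∈ V, ∀ w ∈ V, v * w ∈ V := by
    intro v hv w hw
    refine Submodule.span_induction (p := fun w _ => v * w ∈ V) ?_ ?_ ?_ ?_ hw
    · rintro _ ⟨i, rfl⟩
      exact hVmul_pow v hv _
    · rw [mul_zero]; exact Submodule.zero_mem _
    · intro w₁ w₂ _ _ h₁ h₂
      rw [mul_add]; exact Submodule.add_mem _ h₁ h₂
    · intro l w _ h
      rw [mul_smul_comm]; exact Submodule.smul_mem _ _ h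
  have hVone : (1 : κ) ∈ V := by simpa using hfrobV 1
  let VS : Subring κ :=
    { carrier := V
      mul_mem' := fun ha hb => hVmul _ ha _ hb
      one_mem' := hVone
      add_mem' := fun ha hb => Submodule.add_mem _ ha hb
      zero_mem' := Submodule.zero_mem _
      neg_mem' := fun ha => Submodule.neg_mem _ ha }
  have hLV : ∀ l : L, (l : κ) ∈ V := fun l => by
    have : (l : κ) = l • (1 : κ) := by rw [Algebra.smul_def, mul_one]; rfl
    rw [this]; exact Submodule.smul_mem _ _ hVone
  have hclV : Subring.closure (Set.range (frobenius κ p) ∪ A) ≤ VS := by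
    rw [Subring.closure_le]
    rintro z (⟨w, rfl⟩ | hz)
    · exact hfrobV w
    · exact hLV ⟨z, Subfield.subset_closure (Or.inr hz)⟩
  -- `k'` as an `L`-subspace of `V`
  let W : Submodule L κ :=
    { carrier := k'
      add_mem' := fun ha hb => k'.add_mem ha hb
      zero_mem' := k'.zero_mem
      smul_mem' := fun l z hz => by
        rw [Algebra.smul_def]
        exact k'.mul_mem (hLk l.2) hz }
  have hWV : W ≤ V := fun z hz => hclV (hk' hz)
  haveI : FiniteDimensional L V := FiniteDimensional.span_of_finite L (Set.finite_range _)
  haveI : FiniteDimensional L W := Submodule.finiteDimensional_of_le hWV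
  obtain ⟨b, hb⟩ : W.FG := Module.Finite.iff_fg.mp inferInstance
  refine ⟨b, fun z hz => ?_, fun z hz => ?_⟩
  · have : z ∈ W := hb ▸ Submodule.subset_span hz
    exact this
  · have hzW : z ∈ Submodule.span L (↑b : Set κ) := hb ▸ (hz : z ∈ W)
    refine Submodule.span_induction (p := fun z _ =>
      z ∈ Subring.closure (frobenius κ p '' (k' : Set κ) ∪ A ∪ ↑b)) ?_ ?_ ?_ ?_ hzW
    · intro y hy
      exact Subring.subset_closure (Or.inr hy)
    · exact Subring.zero_mem _
    · intro y₁ y₂ _ _ h₁ h₂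
      exact Subring.add_mem _ h₁ h₂
    · intro l y _ hy
      rw [Algebra.smul_def]
      refine Subring.mul_mem _ ?_ hy
      -- `L ⊆ k'^p[A]` as subrings (the subring closure is a field)
      have hLcl : (L : Set κ) ⊆ Subring.closure (frobenius κ p '' (k' : Set κ) ∪ A) := by
        let F : Subfield κ :=
          { Subring.closure (frobenius κ p '' (k' : Set κ) ∪ A) with
            inv_mem' := fun z hz => inv_mem_subringClosure_of_frobenius_image p k' _ hgen_k
              Set.subset_union_left hz }
        have : L ≤ F := Subfield.closure_le.mpr fun z hz => Subring.subset_closure hz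
        exact fun z hz => this hz
      exact Subring.closure_mono Set.subset_union_left (hLcl l.2)

end Summit.ResolutionOfSingularities.ResolutionOfSingularities.Theorems.RadicialJung.CleanModels
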